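import Literature.MathematicalPhysics.QuantumFieldTheory.Balaban1983to89.B7Prop2Explicit
import Literature.MathematicalPhysics.QuantumFieldTheory.Balaban1983to89.B7Prop3Flat

/-!
# `Balaban1983to89.B7Prop7RegimeNonVacuity` — T. Bałaban, *Averaging operations for lattice gauge theories*, Commun. Math. Phys. **98** (1985) 17–51 [Balaban1985Averaging]
# Proposition 2 (52) p. 26, Proposition 4 (130)–(133) p. 38, Proposition 7 p. 43 («α₀, α₁ sufficiently small»): **THE DISPLAYED NUMERICS OF THE `k`-LEVEL AVERAGING
# REGIME ARE JOINTLY SATISFIABLE FOR EVERY DIMENSION AND EVERY `L ≥ 1`** — the smallness side-conditions carried as HYPOTHESES by the cell's lattice-uniform chart faces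
# (`Support/NE9CurChartTowerPiLatticeUniform…`, `…LipschitzAtFlatLatticeUniform(C)`: `C₀α₀ ≤ 1∕3`, `8α₀ ≤ c₂′`, Prop. 4's `e^{4·800(d+1)²(d+4)α₀}(1 + 8C₁ρ) ≤ 2`, `2ρ ≤ c₃`, and
# Prop. 7's polydisc pack in the coarse radii `r′`, `r₇`) hold SIMULTANEOUSLY for explicit positive `α₀, ρ, r′, r₇` — so those faces are not vacuous in their numerics.  Elementary:
# `|e^x − 1| ≤ 2|x|` for `|x| ≤ 1` (`Real.abs_exp_sub_one_le`) at `x ≤ 1∕8`, and `(5∕4)(1 + 1∕4) ≤ 2`.  NE9 crux-team LEAF PROVER 01 (`b2b-balaban-t4-ne9-formalise-leaf-01`), gen 104;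
# cell `pub-balaban`∕`t4`, row NE9.  WHAT IS PROVED (sorry-free; 0 `def`): **`exists_regime_numerics`** (+ the private `exp_le_of_le_eighth`).  HONEST SCOPE: [folklore] arithmetic on the tree's
# constants `C0`, `c2'`, `c3`; nothing of print is asserted; crude (NOT print's optimal `α₀`).  HONEST DEPENDENCY (cell line): continuum YM on T⁴ ⇐ BetaPertH ∧ nine spine
# estimates (0/9 proved); BetaPertH ⇐ (D1) ∧ (D4) ∧ CAP+tail; G-an2-4 gates asym, D1 and NE2/3/4.

statement-level skeleton of published theorems with citation tags; proofs where landed; nothing here is a claim about the Yang–Mills mass gap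
-/

noncomputable section

namespace Literature.MathematicalPhysics.QuantumFieldTheory.Balaban1983to89.B7Prop7RegimeNonVacuity

open B7Prop2Explicit (C0 c2' C0_pos c2'_pos)
open B7Prop3Flat (c3 c3_pos)

/-- `e^x ≤ 5∕4` for `0 ≤ x ≤ 1∕8` (`|e^x − 1| ≤ 2|x|` on `|x| ≤ 1`). [folklore] -/
private theorem exp_le_of_le_eighth {x : ℝ} (h0 : 0 ≤ x) (h8 : x ≤ 1 / 8) : Real.exp x ≤ 5 / 4 := by
  have h := Real.abs_exp_sub_one_le (x := x) (by rw [abs_of_nonneg h0]; linarith)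
  rw [abs_of_nonneg h0] at h
  have h' := (abs_le.1 h).2
  linarith

set_option maxHeartbeats 800000 in
/-- **THE REGIME NUMERICS ARE JOINTLY SATISFIABLE**: for every `d` and `L ≥ 1` there are `α₀, ρ, r′, r₇ > 0` with `C₀α₀ ≤ 1∕3`, `8α₀ ≤ c₂′` (hence `4α₀ ≤ c₂′`),
Prop. 4's smallness at `ρ` and `2ρ ≤ c₃`, and Prop. 7's polydisc pack at `(r′, r₇)`: `e^{4·800(d+1)²(d+4)α₀}(1 + 8·131072(d+1)²r′) ≤ 2`, `2r′ ≤ c₃`, `409600(d+1)²r′ ≤ 1`,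
`e^{4480(d+1)²(d+4)α₀ + 240000(d+1)³r′}(1 + 8·2097152(d+1)²r₇) ≤ 2`, `2r₇ ≤ c₃∕4`. [folklore]
[cite: Balaban1985Averaging, Proposition 2 (52) p.26, Proposition 4 (130)–(133) p.38, Proposition 7 p.43] -/
theorem exists_regime_numerics (d L : ℕ) (hL : 1 ≤ L) :
    ∃ α₀ ρ r' r₇ : ℝ, 0 < α₀ ∧ 0 < ρ ∧ 0 < r' ∧ 0 < r₇ ∧ C0 d * α₀ ≤ 1 / 3 ∧ 8 * α₀ ≤ c2' d L ∧
      Real.exp (4 * (800 * ((d : ℝ) + 1) ^ 2 * ((d : ℝ) + 4)) * α₀) * (1 + 8 * (131072 * ((d : ℝ) + 1) ^ 2) * ρ) ≤ 2 ∧ 2 * ρ ≤ c3 d L ∧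
      Real.exp (4 * (800 * ((d : ℝ) + 1) ^ 2 * ((d : ℝ) + 4)) * α₀) * (1 + 8 * (131072 * ((d : ℝ) + 1) ^ 2) * r') ≤ 2 ∧ 2 * r' ≤ c3 d L ∧
      409600 * ((d : ℝ) + 1) ^ 2 * r' ≤ 1 ∧
      Real.exp (4480 * ((d : ℝ) + 1) ^ 2 * ((d : ℝ) + 4) * α₀ + 240000 * ((d : ℝ) + 1) ^ 3 * r') * (1 + 8 * (2097152 * ((d : ℝ) + 1) ^ 2) * r₇) ≤ 2 ∧
      2 * r₇ ≤ c3 d L / 4 := by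
  have hC0 := C0_pos d
  have hc2 := c2'_pos d L hL
  have hc3 := c3_pos d hL
  have hd0 : (0 : ℝ) ≤ d := Nat.cast_nonneg d
  -- the coefficients
  set e₁ : ℝ := 4 * (800 * ((d : ℝ) + 1) ^ 2 * ((d : ℝ) + 4)) with he₁
  set e₂ : ℝ := 4480 * ((d : ℝ) + 1) ^ 2 * ((d : ℝ) + 4) with he₂
  set e₃ : ℝ := 240000 * ((d : ℝ) + 1) ^ 3 with he₃
  set K₁ : ℝ := 8 * (131072 * ((d : ℝ) + 1) ^ 2) with hK₁
  set K₂ : ℝ := 8 * (2097152 * ((d : ℝ) + 1) ^ 2) with hK₂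
  obtain ⟨he₁0, he₂0, he₃0, hK₁0, hK₂0⟩ : 0 < e₁ ∧ 0 < e₂ ∧ 0 < e₃ ∧ 0 < K₁ ∧ 0 < K₂ := ⟨by positivity, by positivity, by positivity, by positivity, by positivity⟩
  -- the choices
  set α₀ : ℝ := min (min (1 / (3 * C0 d)) (c2' d L / 8)) (1 / (16 * (e₁ + e₂))) with hα₀
  set r' : ℝ := min (min (c3 d L / 2) (1 / (409600 * ((d : ℝ) + 1) ^ 2))) (min (1 / (16 * e₃)) (1 / (4 * K₁))) with hr'
  set ρ : ℝ := min (c3 d L / 2) (1 / (4 * K₁)) with hρ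
  set r₇ : ℝ := min (c3 d L / 8) (1 / (4 * K₂)) with hr₇
  have hα₀0 : 0 < α₀ := lt_min (lt_min (by positivity) (by positivity)) (by positivity)
  have hr'0 : 0 < r' := lt_min (lt_min (by positivity) (by positivity)) (lt_min (by positivity) (by positivity))
  have hρ0 : 0 < ρ := lt_min (by positivity) (by positivity)
  have hr₇0 : 0 < r₇ := lt_min (by positivity) (by positivity)
  -- the elementary consequences of the `min`s
  have hα1 : α₀ ≤ 1 / (3 * C0 d) := (min_le_left _ _).trans (min_le_left _ _)
  have hα2 : α₀ ≤ c2' d L / 8 := (min_le_left _ _).trans (min_le_right _ _)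
  have hα3 : α₀ ≤ 1 / (16 * (e₁ + e₂)) := min_le_right _ _
  have hr1 : r' ≤ c3 d L / 2 := (min_le_left _ _).trans (min_le_left _ _)
  have hr2 : r' ≤ 1 / (409600 * ((d : ℝ) + 1) ^ 2) := (min_le_left _ _).trans (min_le_right _ _)
  have hr3 : r' ≤ 1 / (16 * e₃) := (min_le_right _ _).trans (min_le_left _ _)
  have hr4 : r' ≤ 1 / (4 * K₁) := (min_le_right _ _).trans (min_le_right _ _)
  have hρ1 : ρ ≤ c3 d L / 2 := min_le_left _ _
  have hρ2 : ρ ≤ 1 / (4 * K₁) := min_le_right _ _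
  have hr₇1 : r₇ ≤ c3 d L / 8 := min_le_left _ _
  have hr₇2 : r₇ ≤ 1 / (4 * K₂) := min_le_right _ _
  -- the exponents are `≤ 1∕8`
  have hx₁ : e₁ * α₀ ≤ 1 / 8 := by
    have h := mul_le_mul_of_nonneg_left hα3 he₁0.le
    have h2 : e₁ * (1 / (16 * (e₁ + e₂))) ≤ 1 / 8 := by
      rw [mul_one_div, div_le_div_iff₀ (by positivity) (by norm_num)]; linarith
    linarith
  have hx₂ : e₂ * α₀ + e₃ * r' ≤ 1 / 8 := by
    have h := mul_le_mul_of_nonneg_left hα3 he₂0.le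
    have h2 : e₂ * (1 / (16 * (e₁ + e₂))) ≤ 1 / 16 := by
      rw [mul_one_div, div_le_div_iff₀ (by positivity) (by norm_num)]; linarith
    have h3 := mul_le_mul_of_nonneg_left hr3 he₃0.le
    have h4 : e₃ * (1 / (16 * e₃)) = 1 / 16 := by field_simp
    linarith
  have hK₁ρ : K₁ * ρ ≤ 1 / 4 := by
    have h := mul_le_mul_of_nonneg_left hρ2 hK₁0.le
    have h2 : K₁ * (1 / (4 * K₁)) = 1 / 4 := by field_simp
    linarith
  have hK₁r : K₁ * r' ≤ 1 / 4 := by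
    have h := mul_le_mul_of_nonneg_left hr4 hK₁0.le
    have h2 : K₁ * (1 / (4 * K₁)) = 1 / 4 := by field_simp
    linarith
  have hK₂r : K₂ * r₇ ≤ 1 / 4 := by
    have h := mul_le_mul_of_nonneg_left hr₇2 hK₂0.le
    have h2 : K₂ * (1 / (4 * K₂)) = 1 / 4 := by field_simp
    linarith
  have hE₁ : Real.exp (e₁ * α₀) ≤ 5 / 4 := exp_le_of_le_eighth (by positivity) hx₁
  have hE₂ : Real.exp (e₂ * α₀ + e₃ * r') ≤ 5 / 4 := exp_le_of_le_eighth (by positivity) hx₂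
  have hprod : ∀ (E t : ℝ), 0 ≤ E → E ≤ 5 / 4 → 0 ≤ t → t ≤ 1 / 4 → E * (1 + t) ≤ 2 := fun E t hE0 hE ht0 ht =>
    (mul_le_mul hE (by linarith : 1 + t ≤ 5 / 4) (by linarith) (by norm_num)).trans (by norm_num)
  refine ⟨α₀, ρ, r', r₇, hα₀0, hρ0, hr'0, hr₇0, ?_, by linarith, ?_, by linarith, ?_, by linarith, ?_, ?_, by linarith⟩
  · have h := mul_le_mul_of_nonneg_left hα1 hC0.le
    have h2 : C0 d * (1 / (3 * C0 d)) = 1 / 3 := by field_simp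
    linarith
  · have e : 4 * (800 * ((d : ℝ) + 1) ^ 2 * ((d : ℝ) + 4)) * α₀ = e₁ * α₀ := by rw [he₁]
    rw [e]; exact hprod _ _ (Real.exp_pos _).le hE₁ (by positivity) hK₁ρ
  · have e : 4 * (800 * ((d : ℝ) + 1) ^ 2 * ((d : ℝ) + 4)) * α₀ = e₁ * α₀ := by rw [he₁]
    rw [e]; exact hprod _ _ (Real.exp_pos _).le hE₁ (by positivity) hK₁r
  · have h := mul_le_mul_of_nonneg_left hr2 (by positivity : (0 : ℝ) ≤ 409600 * ((d : ℝ) + 1) ^ 2)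
    have h2 : 409600 * ((d : ℝ) + 1) ^ 2 * (1 / (409600 * ((d : ℝ) + 1) ^ 2)) = 1 := by field_simp
    linarith
  · have e : 4480 * ((d : ℝ) + 1) ^ 2 * ((d : ℝ) + 4) * α₀ + 240000 * ((d : ℝ) + 1) ^ 3 * r' = e₂ * α₀ + e₃ * r' := by rw [he₂, he₃]
    rw [e]; exact hprod _ _ (Real.exp_pos _).le hE₂ (by positivity) hK₂r

end Literature.MathematicalPhysics.QuantumFieldTheory.Balaban1983to89.B7Prop7RegimeNonVacuity

end
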